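import Mathlib.Analysis.SpecialFunctions.Integrals.Basic
import Mathlib.Data.List.GetD
import HarnessLib

/-!
# List polynomials over `ℚ` with kernel-computable arithmetic (univariate and `x`/`t`-bivariate)

Cell `rh-explicit` (HOME `run/shared/lean/pub/rh-explicit/`), seat cc-s2-4 (`HOME/cc-s2-4/CC4-THRESHOLD-PLAN.md` §2).
Bookkeeping layer for NEGATIVE certificates of the semi-local threshold `a*({2})` (companion file
`SemilocalPolyWitness.lean`): coefficient lists `List ℚ` with Horner evaluation into `ℝ` (`LQ.ev`) and into `ℚ`
(`LQ.evQ`, kernel-computable; `ev_ratCast` links them), `add`, `smul`, `neg`, `mul`, `pow`, the antiderivative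
`integ` with `integral_ev : ∫_u^v ev p = ev (integ p) v − ev (integ p) u`, the absolute bound `absBound`, the odd
test `isOddList`; and lists of lists as polynomials in `x` with `t`-polynomial coefficients (`evalB`) with the
Taylor shift `shiftB p ↦ p(x + t)`, the product `mulUB : p(x)·Q(x,t)` and the definite `x`-integral `intB` between
polynomial limits (`integral_evalB`).  Every `def` reduces in the kernel, so certificate checks built on it are
`decide` over `ℚ`.  Only folklore (Horner 1819; interval/list polynomial arithmetic as in R. E. Moore,
*Interval Analysis* (1966) Ch. 3); written fresh because the tree's `PolyMP.evalR/addR/mulR/shiftR`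
(`Literature/Analysis/ValidatedNumerics/IntervalPolynomial.lean`) are `ℝ`-valued shadows without a rational
twin or the bivariate layer.  No facts, no axioms, nothing about `ζ`.
-/

set_option linter.dupNamespace false  -- the mandated namespace repeats `RiemannHypothesis`

open MeasureTheory Set Finset

namespace Summit.RiemannHypothesis.RiemannHypothesis.Theorems.SemilocalPolyWitness

/-! ## List polynomials over `ℚ` -/

namespace LQ

/-- Horner evaluation of a rational coefficient list at a real point. -/
noncomputable def ev : List ℚ → ℝ → ℝ
  | [], _ => 0
  | a :: as, x => (a : ℝ) + x * ev as x

/-- Horner evaluation at a rational point (kernel-computable). -/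
def evQ : List ℚ → ℚ → ℚ
  | [], _ => 0
  | a :: as, x => a + x * evQ as x

/-- Evaluation of the empty list. -/
@[simp] theorem ev_nil (x : ℝ) : ev [] x = 0 := rfl

/-- Horner step. -/
@[simp] theorem ev_cons (a : ℚ) (as : List ℚ) (x : ℝ) : ev (a :: as) x = (a : ℝ) + x * ev as x := rfl

/-- Real evaluation at a rational point is the cast of the rational evaluation. -/
theorem ev_ratCast : ∀ (p : List ℚ) (q : ℚ), ev p (q : ℝ) = ((evQ p q : ℚ) : ℝ)
  | [], q => by simp [evQ]
  | a :: as, q => by simp only [ev_cons, evQ, ev_ratCast as q]; push_cast; ring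

/-- Sum form of the Horner evaluation. -/
theorem ev_eq_sum : ∀ (p : List ℚ) (x : ℝ), ev p x = ∑ j ∈ range p.length, ((p.getD j 0 : ℚ) : ℝ) * x ^ j
  | [], x => by simp
  | a :: as, x => by
      rw [ev_cons, ev_eq_sum as x, List.length_cons, Finset.sum_range_succ', Finset.mul_sum]
      simp only [List.getD_cons_succ, List.getD_cons_zero, pow_zero, mul_one, pow_succ]
      rw [add_comm]
      congr 1
      exact Finset.sum_congr rfl fun j _ ↦ by ring

/-- Coefficientwise sum. -/
def add : List ℚ → List ℚ → List ℚ
  | [], bs => bs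
  | a :: as, [] => a :: as
  | a :: as, b :: bs => (a + b) :: add as bs

/-- Evaluation of a sum. -/
theorem ev_add : ∀ (p q : List ℚ) (x : ℝ), ev (add p q) x = ev p x + ev q x
  | [], q, x => by simp [add]
  | a :: as, [], x => by simp [add]
  | a :: as, b :: bs, x => by
      simp only [add, ev_cons, ev_add as bs x]; push_cast; ring

/-- Scalar multiple. -/
def smul (c : ℚ) (p : List ℚ) : List ℚ := p.map (c * ·)

/-- Evaluation of a scalar multiple. -/
theorem ev_smul (c : ℚ) : ∀ (p : List ℚ) (x : ℝ), ev (smul c p) x = (c : ℝ) * ev p x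
  | [], x => by simp [smul]
  | a :: as, x => by
      have := ev_smul c as x
      simp only [smul, List.map_cons, ev_cons] at this ⊢
      rw [this]; push_cast; ring

/-- Negation. -/
def neg (p : List ℚ) : List ℚ := smul (-1) p

/-- Evaluation of a negation. -/
theorem ev_neg (p : List ℚ) (x : ℝ) : ev (neg p) x = -ev p x := by
  rw [neg, ev_smul]; push_cast; ring

/-- Product `(a + x·p)·q = a·q + x·(p·q)`. -/
def mul : List ℚ → List ℚ → List ℚ
  | [], _ => []
  | a :: as, bs => add (smul a bs) (0 :: mul as bs)

/-- Evaluation of a product. -/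
theorem ev_mul : ∀ (p q : List ℚ) (x : ℝ), ev (mul p q) x = ev p x * ev q x
  | [], q, x => by simp [mul]
  | a :: as, q, x => by
      simp only [mul, ev_add, ev_smul, ev_cons, ev_mul as q x]; push_cast; ring

/-- Powers. -/
def pow (p : List ℚ) : ℕ → List ℚ
  | 0 => [1]
  | n + 1 => mul p (pow p n)

/-- Evaluation of a power. -/
theorem ev_pow (p : List ℚ) (x : ℝ) : ∀ n : ℕ, ev (pow p n) x = ev p x ^ n
  | 0 => by simp [pow]
  | n + 1 => by rw [pow, ev_mul, ev_pow p x n, pow_succ, mul_comm]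

/-- Antiderivative coefficients from index `k` on: `a_k ↦ a_k/(k+1)`. -/
def integAux : List ℚ → ℕ → List ℚ
  | [], _ => []
  | a :: as, k => (a / (k + 1)) :: integAux as (k + 1)

/-- The antiderivative vanishing at `0`: `∑ a_j x^{j+1}/(j+1)`. -/
def integ (p : List ℚ) : List ℚ := 0 :: integAux p 0

/-- Evaluation of the shifted antiderivative coefficients. -/
theorem ev_integAux : ∀ (p : List ℚ) (k : ℕ) (x : ℝ),
    ev (integAux p k) x = ∑ j ∈ range p.length, ((p.getD j 0 : ℚ) : ℝ) / (k + j + 1) * x ^ j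
  | [], k, x => by simp [integAux]
  | a :: as, k, x => by
      rw [integAux, ev_cons, ev_integAux as (k + 1) x, List.length_cons, Finset.sum_range_succ',
        Finset.mul_sum]
      simp only [List.getD_cons_succ, List.getD_cons_zero, pow_zero, mul_one, pow_succ, Nat.cast_zero,
        add_zero, Nat.cast_succ]
      push_cast
      rw [add_comm]
      congr 1
      exact Finset.sum_congr rfl fun j _ ↦ by ring

/-- `ev (integ p) x = ∑ a_j x^{j+1}/(j+1)`. -/
theorem ev_integ (p : List ℚ) (x : ℝ) :
    ev (integ p) x = ∑ j ∈ range p.length, ((p.getD j 0 : ℚ) : ℝ) * x ^ (j + 1) / (j + 1) := by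
  rw [integ, ev_cons, ev_integAux, Finset.mul_sum]
  push_cast
  simp only [zero_add]
  exact Finset.sum_congr rfl fun j _ ↦ by ring

/-- **The definite integral of a list polynomial.** -/
theorem integral_ev (p : List ℚ) (u v : ℝ) :
    ∫ x in u..v, ev p x = ev (integ p) v - ev (integ p) u := by
  have e : (fun x ↦ ev p x) = fun x ↦ ∑ j ∈ range p.length, ((p.getD j 0 : ℚ) : ℝ) * x ^ j := by
    funext x; exact ev_eq_sum p x
  rw [e, intervalIntegral.integral_finsetSum (f := fun j x ↦ ((p.getD j 0 : ℚ) : ℝ) * x ^ j)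
    (fun j _ ↦ ((continuous_const (y := ((p.getD j 0 : ℚ) : ℝ))).mul (continuous_pow j)).intervalIntegrable _ _)]
  simp_rw [intervalIntegral.integral_const_mul, integral_pow]
  rw [ev_integ, ev_integ, ← Finset.sum_sub_distrib]
  exact Finset.sum_congr rfl fun j _ ↦ by ring

/-- `ev` is continuous. -/
theorem continuous_ev : ∀ p : List ℚ, Continuous (ev p)
  | [] => by change Continuous fun _ : ℝ ↦ (0 : ℝ); exact continuous_const
  | a :: as => by
      have := continuous_ev as
      simp only [ev]
      fun_prop

/-- Absolute bound `|a₀| + h(|a₁| + h(…))` (a rational number for rational `h`). -/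
def absBound : List ℚ → ℚ → ℚ
  | [], _ => 0
  | a :: as, h => |a| + h * absBound as h

/-- The absolute bound is non-negative. -/
theorem absBound_nonneg : ∀ (p : List ℚ) {h : ℚ}, 0 ≤ h → 0 ≤ absBound p h
  | [], _, _ => le_rfl
  | a :: as, h, hh => by
      have := absBound_nonneg as hh
      simp only [absBound]; positivity

/-- `|p(y)| ≤ absBound p h` for `|y| ≤ h`. -/
theorem abs_ev_le_absBound : ∀ (p : List ℚ) {y : ℝ} {h : ℚ}, |y| ≤ h → |ev p y| ≤ (absBound p h : ℝ)
  | [], y, h, _ => by simp [absBound]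
  | a :: as, y, h, hy => by
      have hh : (0 : ℝ) ≤ h := (abs_nonneg y).trans hy
      have ih := abs_ev_le_absBound as hy
      have hb : (0 : ℝ) ≤ absBound as h := by exact_mod_cast absBound_nonneg as (by exact_mod_cast hh)
      simp only [ev_cons, absBound]
      push_cast
      calc |(a : ℝ) + y * ev as y| ≤ |(a : ℝ)| + |y * ev as y| := abs_add_le _ _
        _ = |(a : ℝ)| + |y| * |ev as y| := by rw [abs_mul]
        _ ≤ |(a : ℝ)| + h * absBound as h := by gcongr

/-- Boolean test: all even-indexed coefficients of the list vanish (an ODD polynomial). -/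
def isOddList (p : List ℚ) : Bool :=
  (List.range p.length).all fun j ↦ j % 2 == 1 || p.getD j 0 == 0

/-- An odd list has vanishing even-indexed coefficients (indices beyond the length are `0` anyway). -/
theorem getD_two_mul_eq_zero {p : List ℚ} (hp : isOddList p = true) (j : ℕ) : p.getD (2 * j) 0 = 0 := by
  by_cases hj : 2 * j < p.length
  · have h := List.all_eq_true.1 hp (2 * j) (List.mem_range.2 hj)
    simp only [Nat.mul_mod_right, Bool.or_eq_true, beq_iff_eq] at h
    rcases h with h | h
    · exact absurd h (by norm_num)
    · exact h
  · exact List.getD_eq_default _ _ (by omega)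

/-- An odd coefficient list evaluates to an odd function. -/
theorem ev_neg_of_isOddList {p : List ℚ} (hp : isOddList p = true) (x : ℝ) : ev p (-x) = -ev p x := by
  rw [ev_eq_sum, ev_eq_sum, ← Finset.sum_neg_distrib]
  refine Finset.sum_congr rfl fun j _ ↦ ?_
  rcases Nat.even_or_odd j with ⟨k, rfl⟩ | ⟨k, rfl⟩
  · rw [← two_mul, getD_two_mul_eq_zero hp k]; simp
  · rw [Odd.neg_pow ⟨k, rfl⟩]; ring

/-! ### Bivariate lists: polynomials in `x` whose coefficients are polynomials in `t` -/

/-- Evaluation of a list of `t`-coefficient lists: `∑_j c_j(t) x^j` (Horner in `x`). -/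
noncomputable def evalB : List (List ℚ) → ℝ → ℝ → ℝ
  | [], _, _ => 0
  | c :: cs, x, t => ev c t + x * evalB cs x t

/-- Evaluation of the empty bivariate list. -/
@[simp] theorem evalB_nil (x t : ℝ) : evalB [] x t = 0 := rfl

/-- Horner step in `x`. -/
@[simp] theorem evalB_cons (c : List ℚ) (cs : List (List ℚ)) (x t : ℝ) :
    evalB (c :: cs) x t = ev c t + x * evalB cs x t := rfl

/-- Sum form in `x`. -/
theorem evalB_eq_sum : ∀ (B : List (List ℚ)) (x t : ℝ),
    evalB B x t = ∑ j ∈ range B.length, ev (B.getD j []) t * x ^ j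
  | [], x, t => by simp
  | c :: cs, x, t => by
      rw [evalB_cons, evalB_eq_sum cs x t, List.length_cons, Finset.sum_range_succ', Finset.mul_sum]
      simp only [List.getD_cons_succ, List.getD_cons_zero, pow_zero, mul_one, pow_succ]
      rw [add_comm]
      congr 1
      exact Finset.sum_congr rfl fun j _ ↦ by ring

/-- Coefficientwise sum of bivariate lists. -/
def addB : List (List ℚ) → List (List ℚ) → List (List ℚ)
  | [], B => B
  | c :: cs, [] => c :: cs
  | c :: cs, d :: ds => add c d :: addB cs ds

/-- Evaluation of a bivariate sum. -/
theorem evalB_addB : ∀ (A B : List (List ℚ)) (x t : ℝ), evalB (addB A B) x t = evalB A x t + evalB B x t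
  | [], B, x, t => by simp [addB]
  | c :: cs, [], x, t => by simp [addB]
  | c :: cs, d :: ds, x, t => by
      simp only [addB, evalB_cons, ev_add, evalB_addB cs ds x t]; ring

/-- Multiplication by `(x + t)`: `x·Q` shifts the `x`-coefficients, `t·Q` multiplies each by `t`. -/
def mulXT (B : List (List ℚ)) : List (List ℚ) := addB ([] :: B) (B.map fun c ↦ 0 :: c)

/-- Multiplying every `x`-coefficient by `t`. -/
theorem evalB_map_mulT : ∀ (B : List (List ℚ)) (x t : ℝ),
    evalB (B.map fun c ↦ (0 : ℚ) :: c) x t = t * evalB B x t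
  | [], x, t => by simp
  | c :: cs, x, t => by
      simp only [List.map_cons, evalB_cons, ev_cons, evalB_map_mulT cs x t]; push_cast; ring

/-- Evaluation of `(x + t)·Q`. -/
theorem evalB_mulXT (B : List (List ℚ)) (x t : ℝ) : evalB (mulXT B) x t = (x + t) * evalB B x t := by
  rw [mulXT, evalB_addB, evalB_map_mulT, evalB_cons, ev_nil]; ring

/-- **Taylor shift**: the bivariate list of `p(x + t)` (`a + (x+t)·q(x+t)`). -/
def shiftB : List ℚ → List (List ℚ)
  | [] => []
  | a :: as => addB [[a]] (mulXT (shiftB as))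

/-- **Soundness of the Taylor shift**: `shiftB p` evaluates to `p(x + t)`. -/
theorem evalB_shiftB : ∀ (p : List ℚ) (x t : ℝ), evalB (shiftB p) x t = ev p (x + t)
  | [], x, t => by simp [shiftB]
  | a :: as, x, t => by
      rw [shiftB, evalB_addB, evalB_mulXT, evalB_shiftB as x t, evalB_cons, ev_cons, ev_cons, ev_nil,
        evalB_nil]
      ring

/-- **Product of a univariate (in `x`) list with a bivariate list**: `p(x)·Q(x,t)`. -/
def mulUB : List ℚ → List (List ℚ) → List (List ℚ)
  | [], _ => []
  | a :: as, B => addB (B.map (smul a)) ([] :: mulUB as B)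

/-- Scalar multiple of a bivariate list. -/
theorem evalB_map_smul (a : ℚ) : ∀ (B : List (List ℚ)) (x t : ℝ),
    evalB (B.map (smul a)) x t = (a : ℝ) * evalB B x t
  | [], x, t => by simp
  | c :: cs, x, t => by
      simp only [List.map_cons, evalB_cons, ev_smul, evalB_map_smul a cs x t]; ring

/-- **Soundness of the product** `p(x)·Q(x,t)`. -/
theorem evalB_mulUB : ∀ (p : List ℚ) (B : List (List ℚ)) (x t : ℝ),
    evalB (mulUB p B) x t = ev p x * evalB B x t
  | [], B, x, t => by simp [mulUB]
  | a :: as, B, x, t => by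
      rw [mulUB, evalB_addB, evalB_map_smul, evalB_cons, ev_nil, evalB_mulUB as B x t, ev_cons]; ring

/-- **Definite `x`-integral of a bivariate list between polynomial limits** `u(t)`, `v(t)`:
`∑_j c_j(t) (v(t)^{j+1} − u(t)^{j+1})/(j+1)`, from index `k` on. -/
def intBAux : List (List ℚ) → ℕ → List ℚ → List ℚ → List ℚ
  | [], _, _, _ => []
  | c :: cs, k, u, v =>
      add (mul c (smul (1 / (k + 1)) (add (pow v (k + 1)) (neg (pow u (k + 1)))))) (intBAux cs (k + 1) u v)

/-- `∫_{u(t)}^{v(t)} Q(x,t) dx` as a coefficient list in `t`. -/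
def intB (B : List (List ℚ)) (u v : List ℚ) : List ℚ := intBAux B 0 u v

/-- Evaluation of the shifted integral list. -/
theorem ev_intBAux : ∀ (B : List (List ℚ)) (k : ℕ) (u v : List ℚ) (t : ℝ),
    ev (intBAux B k u v) t =
      ∑ j ∈ range B.length, ev (B.getD j []) t *
        ((ev v t ^ (k + j + 1) - ev u t ^ (k + j + 1)) / (k + j + 1))
  | [], k, u, v, t => by simp [intBAux]
  | c :: cs, k, u, v, t => by
      rw [intBAux, ev_add, ev_mul, ev_smul, ev_add, ev_pow, ev_neg, ev_pow, ev_intBAux cs (k + 1) u v t,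
        List.length_cons, Finset.sum_range_succ']
      simp only [List.getD_cons_succ, List.getD_cons_zero, add_zero, Nat.cast_zero]
      push_cast
      rw [add_comm]
      congr 1
      · exact Finset.sum_congr rfl fun j _ ↦ by rw [show k + 1 + j + 1 = k + (j + 1) + 1 by ring]; ring
      · ring

/-- **Soundness of `intB`**: the `x`-integral of `Q(x,t)` from `u(t)` to `v(t)`. -/
theorem integral_evalB (B : List (List ℚ)) (u v : List ℚ) (t : ℝ) :
    ∫ x in (ev u t)..(ev v t), evalB B x t = ev (intB B u v) t := by
  have e : (fun x ↦ evalB B x t) = fun x ↦ ∑ j ∈ range B.length, ev (B.getD j []) t * x ^ j := by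
    funext x; exact evalB_eq_sum B x t
  rw [e, intervalIntegral.integral_finsetSum (f := fun j x ↦ ev (B.getD j []) t * x ^ j)
    (fun j _ ↦ ((continuous_const (y := ev (B.getD j []) t)).mul (continuous_pow j)).intervalIntegrable _ _)]
  simp_rw [intervalIntegral.integral_const_mul, integral_pow]
  rw [intB, ev_intBAux]
  refine Finset.sum_congr rfl fun j _ ↦ ?_
  simp only [zero_add, Nat.cast_zero]

end LQ

end Summit.RiemannHypothesis.RiemannHypothesis.Theorems.SemilocalPolyWitness
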